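import Mathlib
import Summits.Ventures.FusionMHD.Bench.SAlphaEnclosureChecks3
import Literature.MathematicalPhysics.MHD.BallooningSAlphaPositiveSolution
import HarnessLib

/-!
# F3 — THE `s–α` BALLOONING MODEL AT `(s, α) = (1, 2/5)` IS ON THE STABLE SIDE ON EVERY WINDOW INSIDE `(−51/8, 51/8) ⊃ [−2π, 2π]`:
# a KERNEL-CHECKED ENCLOSURE of the even solution `X₀` (51 validated Taylor steps of `h = 1/8`, order 6, Moore's HOE test in exact
# rational interval arithmetic, `decide`d by the Lean kernel in `Bench/SAlphaEnclosureChecks{1,2,3}.lean`) feeding the Jacobi/Picone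
# socket of `Literature/…/BallooningSAlphaPositiveSolution.lean`
(venture LADDER-GRIDFUSION, rung F3, «#199-cand … PATH W» of gridfusion-lead RULING 9ez (6): «lit-3 socket
`not_unstableWitness_of_clockField` + enclosure + a gridfusion `EChainCert` `check = true` in kernel: `¬UnstableWitness` on every window
`⊆ [−T, T]`, `T = 2π` first»; cell `gridfusion`, typed by gridfusion-lit-3 (g13), 2026-08-28.  ONE composition file: 0 `def … : Prop`
facts, 0 kit jobs, no `native_decide`, no floating point — the stage list below was FOUND by an untrusted search (lit-3's Lean-interpreter
generator: Taylor tube + padding, grid `10⁻⁴`) and is CERTIFIED here only by `EChainCert.check = true` evaluated by the kernel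
(the 102 per-stage facts `okJJc`/`okJJb` of the three check files `Bench/SAlphaEnclosureChecks{1,2,3}.lean` over the data file `Bench/SAlphaEnclosureStages.lean`, ≈ 6 kernel-s each, assembled
here into `chain_check`); any other stage list (e.g. certnum RQ-022's) can be substituted verbatim.)

## The statement (three columns, never merged)
CERTIFIED (kernel, this file): for the `s–α` ballooning model EXACTLY as typed in `Literature/MathematicalPhysics/MHD/BallooningSAlpha.lean`
(Freidberg 2014 §12.6.2 eq. (12.97), `Λ = sθ − α sin θ`, energy `W[X; a, b] = ∫ₐᵇ[(1+Λ²)X′² − α(Λ sin θ + cos θ)X²]dθ`) at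
`s = 1`, `α = 2/5`:
* `chain_check` / `exists_solution`: the clock system `y′ = clockField 1 (2/5) (y)` (`θ̂′ = 1`, `X′ = P/(1+Λ(θ̂)²)`,
  `P′ = −α(Λ(θ̂) sin θ̂ + cos θ̂)X`, lit-3's `Ballooning.SAlpha.clockField`, PROVED equal to the code list `SAlphaEnclosure.sAlphaCode` of
  the data file — `fieldFun_sAlphaCode`) has a solution on `[0, 51/8]` from `y(0) = (0, 1, 0)` (the EVEN solution `X₀(0) = 1`, `X₀′(0) = 0`), and
  EVERY such solution satisfies `X₀(t) = y t 1 ≥ 3/8` for all `t ∈ [0, 51/8]` (`X_ge`, read off the 51 certified a-priori boxes,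
  `apriori_X_lower`) and `X₀(51/8) ∈ [0.426587, 0.426641]`, `P(51/8) ∈ [0.819190, 0.819409]` (`mem_finalBox`);
* ★ `no_unstableWitness`: for every `T < 51/8` and every window `[a, b] ⊆ [−T, T]`, NO `s–α` instability witness exists
  (`¬ Ballooning.SAlpha.UnstableWitness 1 (2/5) a b Y Y′` for all trial pairs) — by lit-3's socket
  `not_unstableWitness_of_clockField` (Hartman 2002 XI §6 Thm 6.2 «only if»: a positive solution ⇒ `W ≥ 0`); in particular
  ★ `no_unstableWitness_2pi` on every window inside `[−2π, 2π]` (`2π < 51/8` from `π < 3.15`) and `energy_nonneg_2pi`: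
  every `Y` differentiable on `[a, b] ⊆ [−2π, 2π]`, `a < b`, `Y(a) = Y(b) = 0` has `W[Y; a, b] ≥ 0`.
VALIDATED (juxtaposed, never merged): Freidberg's marginal-stability diagram Fig. 12.5 / `α ≈ 0.6 s` (12.100) puts `(1, 2/5)` inside the
first stability region; lit-3's float shadow (STATUS 03:44Z: `min_{[0,2π]} X₀ = 0.39784` at `θ ≈ 4.59`, `X₀(2π) = 0.42474`) agrees with
the certified boxes; the WHOLE LINE (`T = ∞`) is NOT claimed here (that is the tail argument of «#199-cand PATH P», model-7 / lit-4).
MODELLED: the `s–α` model (large-aspect-ratio circular tokamak, high-`n` ballooning ordering, shifted circles, `θ₀ = 0`, ideal MHD);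
«stable on a window» = the model's one-surface quadratic form is `≥ 0` on trial functions supported in the window; the
representation step to the 2-D `δW` (Connor–Hastie–Taylor 1979) is quoted in `BallooningSAlpha.lean`, not typed; no device.

## Method (all by name)
`Literature.Analysis.ODE.EChainCert` (Moore 1979 §8.1 (8.13) high-order-enclosure chain for ELEMENTARY fields, soundness
`EChainCert.sound`: `check = true` ⇒ existence on the mesh and enclosure of EVERY solution in the a-priori boxes), the derived program at
`40`-bit outward rounding with `sin`/`cos` seeds at scale `2^30` (`⟨40, 30, 12, 3, 0⟩`, as the tree's pendulum example), and
`Literature.MathematicalPhysics.MHD.Ballooning.SAlpha.not_unstableWitness_of_clockField` (p602810).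

## Sources
* J. P. Freidberg, *Ideal MHD*, CUP 2014 [Freidberg2014] §12.6.2 eq. (12.97), Fig. 12.5 (via `BallooningSAlpha.lean`).
* P. Hartman, *Ordinary Differential Equations*, SIAM 2002 [Hartman2002] Ch. XI §6 Thm. 6.2 (via `BallooningSAlphaPositiveSolution.lean`).
* R. E. Moore, *Methods and Applications of Interval Analysis*, SIAM 1979 [Moore1979] §8.1 (8.13) (via `ElementaryFieldChainCertificate.lean`).
-/

noncomputable section

open Real Set NonemptyInterval
open Literature.Analysis.ODE Literature.Analysis.ValidatedNumerics Literature.Analysis.ValidatedNumerics.ITaylor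
open Literature.MathematicalPhysics.MHD.Ballooning.SAlpha

namespace Summit.Ventures.FusionMHD.Bench.SAlphaEnclosure

/-! ## §1 The code list denotes the clock field at `(s, α) = (1, 2/5)` -/

/-- THE CODE LIST DENOTES lit-3's `clockField 1 (2/5)` (the `s–α` equation (12.97) in clock form): the hypothesis shape of the socket.
[cite: Freidberg2014, §12.6.2 eq. (12.97)] -/
theorem fieldFun_sAlphaCode : FExpr.fieldFun sAlphaCode = clockField 1 (2/5) := by
  funext y i
  fin_cases i
  · simp [FExpr.fieldFun, sAlphaCode, FExpr.eval, clockField]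
  · simp [FExpr.fieldFun, sAlphaCode, FExpr.eval, clockField, bending, shearParam]
  · simp [FExpr.fieldFun, sAlphaCode, FExpr.eval, clockField, drive, shearParam]

/-! ## §2 The 51-step transcript: kernel acceptance, mesh, existence, enclosure -/

/-- ★ **THE KERNEL ACCEPTS THE 51-STEP TRANSCRIPT**: `chain.check = true`, assembled from the 51 step tests `okJJc` and the 51 landing
tests `okJJb` of the data files (each `decide`d by the kernel in exact rational interval arithmetic) by unfolding the chain checker along
the stage list. [cite: Moore1979, §8.1 eq. (8.13)] [cite: NedialkovJacksonCorliss1999, §5 Algorithm I] -/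
theorem chain_check : chain.check = true := by
  show eChainCheck sAlphaCode cfg finalBox stages = true
  simp only [stages, eChainCheck, nextInit, ok00c, ok00b, ok01c, ok01b, ok02c, ok02b, ok03c, ok03b, ok04c, ok04b,
    ok05c, ok05b, ok06c, ok06b, ok07c, ok07b, ok08c, ok08b, ok09c, ok09b, ok10c, ok10b, ok11c, ok11b, ok12c, ok12b,
    ok13c, ok13b, ok14c, ok14b, ok15c, ok15b, ok16c, ok16b, ok17c, ok17b, ok18c, ok18b, ok19c, ok19b, ok20c, ok20b,
    ok21c, ok21b, ok22c, ok22b, ok23c, ok23b, ok24c, ok24b, ok25c, ok25b, ok26c, ok26b, ok27c, ok27b, ok28c, ok28b,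
    ok29c, ok29b, ok30c, ok30b, ok31c, ok31b, ok32c, ok32b, ok33c, ok33b, ok34c, ok34b, ok35c, ok35b, ok36c, ok36b,
    ok37c, ok37b, ok38c, ok38b, ok39c, ok39b, ok40c, ok40b, ok41c, ok41b, ok42c, ok42b, ok43c, ok43b, ok44c, ok44b,
    ok45c, ok45b, ok46c, ok46b, ok47c, ok47b, ok48c, ok48b, ok49c, ok49b, ok50c, ok50b, Bool.and_self]

/-- 51 steps. [cite: Moore1979, §8.1 eq. (8.13)] -/
theorem chain_size : chain.size = 51 := rfl

/-- Every step has length `1/8`. [cite: Moore1979, §8.1 eq. (8.13)] -/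
theorem step_eq : ∀ j < 51, (chain.toHOEChain.stageAt j).step = 1 / 8 := by
  decide +kernel

/-- The mesh is uniform: `τⱼ = j/8` for `j ≤ 51`. [cite: Moore1979, §8.1 eq. (8.13)] -/
theorem mesh_eq : ∀ j ≤ 51, chain.toHOEChain.mesh j = (j : ℝ) / 8 := by
  intro j hj
  induction j with
  | zero => simp
  | succ k ih =>
    rw [HOEChainCert.mesh_succ, ih (by omega), step_eq k (by omega)]
    push_cast
    ring

/-- The horizon is `τ₅₁ = 51/8`. [cite: Moore1979, §8.1 eq. (8.13)] -/
theorem mesh_size : chain.toHOEChain.mesh chain.size = 51 / 8 := by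
  rw [chain_size, mesh_eq 51 le_rfl]; norm_num

/-- The initial value `(0, 1, 0)` is `W₀`. [cite: Moore1979, §8.1 eq. (8.13)] -/
theorem init_mem : (![0, 1, 0] : Fin 3 → ℝ) ∈ boxSet (castBox (chain.initAt 0)) := by
  rw [mem_boxSet_iff]
  intro i
  fin_cases i
  · show (0 : ℝ) ∈ (NonemptyInterval.pure (0 : ℚ)).ratCast ℝ
    rw [ratCast_pure, Rat.cast_zero]; exact mem_pure_self _
  · show (1 : ℝ) ∈ (NonemptyInterval.pure (1 : ℚ)).ratCast ℝ
    rw [ratCast_pure, Rat.cast_one]; exact mem_pure_self _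
  · show (0 : ℝ) ∈ (NonemptyInterval.pure (0 : ℚ)).ratCast ℝ
    rw [ratCast_pure, Rat.cast_zero]; exact mem_pure_self _

/-- ★ **EXISTENCE ON `[0, 51/8]`** (kernel-certified): the clock system at `(1, 2/5)` has a solution from `(0, 1, 0)` — an even solution
`X₀` of (12.97) with `X₀(0) = 1`, `X₀′(0) = 0`, in lit-3's socket format. [cite: Moore1979, §8.1 eq. (8.13)]
[cite: Freidberg2014, §12.6.2 eq. (12.97)] -/
theorem exists_solution :
    ∃ y : ℝ → Fin 3 → ℝ, y 0 = ![0, 1, 0] ∧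
      ∀ t ∈ Icc (0 : ℝ) (51 / 8), HasDerivWithinAt y (clockField 1 (2/5) (y t)) (Icc (0 : ℝ) (51 / 8)) t := by
  have h := (EChainCert.sound chain_check init_mem).1
  rwa [mesh_size, show chain.field = sAlphaCode from rfl, fieldFun_sAlphaCode] at h

/-- The certified LOWER END of the `X`-coordinate of every a-priori box is at least `3/8` (the smallest is `0.3775`, on `[4.5, 4.625]`).
[cite: Moore1979, §8.1 eq. (8.13)] -/
theorem apriori_X_lower : ∀ j < 51, (3 / 8 : ℚ) ≤ ((chain.stageAt j).apriori 1).fst := by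
  decide +kernel

/-- Every point of `[0, 51/8]` lies in a step interval `[j/8, (j+1)/8]`, `j < 51`. [folklore] -/
private theorem exists_step {t : ℝ} (ht : t ∈ Icc (0 : ℝ) (51 / 8)) :
    ∃ j < 51, t ∈ Icc (chain.toHOEChain.mesh j) (chain.toHOEChain.mesh (j + 1)) := by
  set j := min ⌊8 * t⌋₊ 50 with hj
  have hj51 : j < 51 := by omega
  refine ⟨j, hj51, ?_⟩
  rw [mesh_eq j hj51.le, mesh_eq (j + 1) (by omega)]
  have h8t : (0 : ℝ) ≤ 8 * t := by linarith [ht.1]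
  have hfl : (⌊8 * t⌋₊ : ℝ) ≤ 8 * t := Nat.floor_le h8t
  have hjle : (j : ℝ) ≤ ⌊8 * t⌋₊ := by exact_mod_cast min_le_left _ _
  constructor
  · rw [div_le_iff₀ (by norm_num : (0 : ℝ) < 8)]; linarith
  · rw [le_div_iff₀ (by norm_num : (0 : ℝ) < 8)]
    rcases le_or_gt ⌊8 * t⌋₊ 50 with h | h
    · have hj' : j = ⌊8 * t⌋₊ := by rw [hj]; exact min_eq_left h
      have hlt : 8 * t < (⌊8 * t⌋₊ : ℝ) + 1 := Nat.lt_floor_add_one _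
      rw [hj']; push_cast; linarith
    · have hj' : j = 50 := by rw [hj]; exact min_eq_right h.le
      rw [hj']; push_cast; linarith [ht.2]

/-- ★ **POSITIVITY OF THE EVEN SOLUTION** (kernel-certified enclosure): every solution of the clock system from `(0, 1, 0)` on
`[0, 51/8]` has `X`-component `≥ 3/8` throughout. [cite: Moore1979, §8.1 eq. (8.13)] -/
theorem X_ge {y : ℝ → Fin 3 → ℝ} (hy0 : y 0 = ![0, 1, 0])
    (hy : ∀ t ∈ Icc (0 : ℝ) (51 / 8), HasDerivWithinAt y (clockField 1 (2/5) (y t)) (Icc (0 : ℝ) (51 / 8)) t)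
    {t : ℝ} (ht : t ∈ Icc (0 : ℝ) (51 / 8)) : (3 / 8 : ℝ) ≤ y t 1 := by
  have hy' : ∀ t ∈ Icc 0 (chain.toHOEChain.mesh chain.size),
      HasDerivWithinAt y (FExpr.fieldFun chain.field (y t)) (Icc 0 (chain.toHOEChain.mesh chain.size)) t := by
    rw [mesh_size]
    show ∀ t ∈ Icc (0 : ℝ) (51 / 8), HasDerivWithinAt y (FExpr.fieldFun sAlphaCode (y t)) (Icc (0 : ℝ) (51 / 8)) t
    rw [fieldFun_sAlphaCode]; exact hy
  have hsound := ((EChainCert.sound chain_check init_mem).2 y hy0 hy').2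
  obtain ⟨j, hj, hjt⟩ := exists_step ht
  have hmem := (hsound j (by rw [chain_size]; exact hj) t hjt).1
  rw [mem_boxSet_iff] at hmem
  have h1 := hmem 1
  rw [castBox_apply, mem_ratCast_iff] at h1
  have hlow := apriori_X_lower j hj
  have hcast : ((3 / 8 : ℚ) : ℝ) ≤ (((chain.stageAt j).apriori 1).fst : ℝ) := by exact_mod_cast hlow
  have h38 : ((3 / 8 : ℚ) : ℝ) = 3 / 8 := by norm_num
  rw [h38] at hcast
  exact hcast.trans h1.1

/-- **The certified final box**: `X₀(51/8) ∈ [34127/80000, 1066601/2500000] ⊂ [0.42658, 0.42665]`, `P(51/8) ∈ [0.81919, 0.81941]`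
for every solution from `(0, 1, 0)`.
[cite: Moore1979, §8.1 eq. (8.13)] -/
theorem mem_finalBox {y : ℝ → Fin 3 → ℝ} (hy0 : y 0 = ![0, 1, 0])
    (hy : ∀ t ∈ Icc (0 : ℝ) (51 / 8), HasDerivWithinAt y (clockField 1 (2/5) (y t)) (Icc (0 : ℝ) (51 / 8)) t) :
    y (51 / 8) ∈ boxSet (castBox chain.final) := by
  have hy' : ∀ t ∈ Icc 0 (chain.toHOEChain.mesh chain.size),
      HasDerivWithinAt y (FExpr.fieldFun chain.field (y t)) (Icc 0 (chain.toHOEChain.mesh chain.size)) t := by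
    rw [mesh_size]
    show ∀ t ∈ Icc (0 : ℝ) (51 / 8), HasDerivWithinAt y (FExpr.fieldFun sAlphaCode (y t)) (Icc (0 : ℝ) (51 / 8)) t
    rw [fieldFun_sAlphaCode]; exact hy
  have h := EChainCert.mem_final chain_check init_mem hy0 hy'
  rwa [mesh_size] at h

/-! ## §3 The stable window -/

/-- ★★ **NO `s–α` INSTABILITY WITNESS ON ANY WINDOW INSIDE `(−51/8, 51/8)` AT `(s, α) = (1, 2/5)`**: for every `T < 51/8`, every window
`[a, b] ⊆ [−T, T]` and every trial pair `(Y, Y′)`, `¬ UnstableWitness 1 (2/5) a b Y Y′` — the kernel-certified positive even solution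
(§2) fed to the Jacobi/Picone socket. [cite: Hartman2002, Ch. XI §6 Thm. 6.2 (proof «only if»)] with [Freidberg2014] §12.3 (12.40)
(Newcomb procedure), §12.6.2 (12.97); enclosure [cite: Moore1979, §8.1 eq. (8.13)] -/
theorem no_unstableWitness {T : ℝ} (hT : T < 51 / 8) {a b : ℝ} (hI : Icc a b ⊆ Icc (-T) T) (Y Y' : ℝ → ℝ) :
    ¬ UnstableWitness 1 (2/5) a b Y Y' := by
  obtain ⟨y, hy0, hy⟩ := exists_solution
  refine not_unstableWitness_of_clockField hT (by norm_num) hy (by simp [hy0]) (by simp [hy0]) (fun t ht => ?_) hI Y Y'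
  have := X_ge hy0 hy ⟨ht.1, ht.2.trans hT.le⟩
  linarith

/-- `2π < 51/8`. [folklore] -/
private theorem two_pi_lt : 2 * π < 51 / 8 := by
  have := Real.pi_lt_d2
  linarith

/-- ★★ **THE WINDOW `[−2π, 2π]`** (RULING 9ew/9ez «T = 2π first»): at `(s, α) = (1, 2/5)` no `C¹` trial function supported in a window
inside `[−2π, 2π]` is an `s–α` instability witness. [cite: Hartman2002, Ch. XI §6 Thm. 6.2 (proof «only if»)] with [Freidberg2014]
§12.6.2 (12.97); enclosure [cite: Moore1979, §8.1 eq. (8.13)] -/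
theorem no_unstableWitness_2pi {a b : ℝ} (hI : Icc a b ⊆ Icc (-(2 * π)) (2 * π)) (Y Y' : ℝ → ℝ) :
    ¬ UnstableWitness 1 (2/5) a b Y Y' :=
  no_unstableWitness two_pi_lt hI Y Y'

/-- The same as NON-NEGATIVE ENERGY: every `Y` differentiable on `[a, b] ⊆ [−2π, 2π]` (`a < b`) with `Y(a) = Y(b) = 0` has
`W[Y; a, b] = ∫ₐᵇ[(1+Λ²)Y′² − (2/5)(Λ sin θ + cos θ)Y²] dθ ≥ 0`, `Λ = θ − (2/5) sin θ`. [cite: Hartman2002, Ch. XI §6 Thm. 6.2 (eq. (6.7))]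
with [Freidberg2014] §12.3 (12.38), §12.6.2 (12.97) -/
theorem energy_nonneg_2pi {a b : ℝ} (hab : a < b) (hI : Icc a b ⊆ Icc (-(2 * π)) (2 * π)) {Y Y' : ℝ → ℝ}
    (hY : ∀ θ ∈ Icc a b, HasDerivAt Y (Y' θ) θ) (ha : Y a = 0) (hb : Y b = 0) :
    0 ≤ energy 1 (2/5) Y Y' a b := by
  obtain ⟨y, hy0, hy⟩ := exists_solution
  refine energy_nonneg_of_clockField two_pi_lt (by norm_num) hy (by simp [hy0]) (by simp [hy0]) (fun t ht => ?_) hab hI hY ha hb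
  have := X_ge hy0 hy ⟨ht.1, ht.2.trans two_pi_lt.le⟩
  linarith

end Summit.Ventures.FusionMHD.Bench.SAlphaEnclosure

end
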